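import Summits.BirchSwinnertonDyer.BirchSwinnertonDyer.Theorems.SylvesterTwoHeegnerIndexTwoAdicPairDescentEngine
import Summits.BirchSwinnertonDyer.BirchSwinnertonDyer.Theorems.SylvesterTwoHeegnerIndexCoupledDescentShaCurrency
import HarnessLib

/-!
# The `m = 0` translation: `ord₂ q = i` forces `Y ∉ 2E(K) + tors` (THEOREM K2's hypothesis)

Third helper (after `…CoupledDescentAtTwo.lean` p620148 = THEOREM K2's deduction, and
`…CoupledDescentShaCurrency.lean` = its Ш-currency corollary) toward crux `UpperOffV0HSYPlus`
(stmt-BirchSwinnertonDyer-19804), VARIANT K stub `stub_firstLayerFour`. That stub's hypothesis is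
`padicValRat 2 (qB * qA) = 0`; THEOREM K2's hypothesis is «HSY's point `Y` is `2`-primitive in
`E_p(K)`» (memo two §57.4: `m(p) = 0`). The cell's Thm B′ bookkeeping links them; the tree's
ENGINE `SylvesterTwoCMNormForm.le_padicValRat_two_of_model` (x1b GEN 48,
`…TwoAdicPairDescentEngine.lean`) already proves the INEQUALITY `i ≤ ord₂ q` from a height identity
`q·ĥ(ιP) = 2^i·ĥ(Y)`. This file proves the EQUALITY CASE in the same frame:

* `not_exists_eq_two_smul_add_torsion_of_padicValRat_eq` — `K/ℚ` quadratic with a conjugation datum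
  and `ω ∈ K`; `B` a model of `E_p` (`C • B = cubeSumCurve p`, `p` an odd prime); `P ∈ B(ℚ)`
  generating `B(ℚ)` modulo torsion, non-torsion in `B(K)`; `rank_ℤ B(K) = 2`; `Y ∈ B(K)` with
  `q·ĥ(ιP) = 2^i·ĥ(Y)`, `q ≠ 0` and `ord₂ q = i`. THEN `Y ∉ 2B(K) + B(K)_tors`. Proof: as in the
  engine, write `n•Y = a•ιP + b•[ω]ιP + T` with `n` odd (odd-index lemma); the explicit quotient
  `q = 2^i(a² − ab + b²)/n²` gives `ord₂(a² − ab + b²) = 0`, so `a, b` are not both even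
  (`2` inert in `ℤ[ω]`); were `Y ∈ 2B(K) + tors`, `a•ιP + b•[ω]ιP ∈ 2B(K) + tors` would force
  `2 ∣ a, 2 ∣ b` (`two_dvd_of_memTwo`, since `ιP ∉ 2B(K) + tors` by descent) — contradiction.
* `not_exists_two_smul_eq_of_padicValRat_eq` — in particular `¬ ∃ Q, 2 • Q = Y`, the hypothesis
  `hY` of `SylvesterTwoCoupledDescentAtTwo.selmerGroup_eq_bot_and_le_closure_of_coupledLeaves` at
  `p = 2` (`δY ≠ 0`).

For `p ≡ 4 (9)` Hu–Shu–Yin's display has `i = 0` and `q = #Ш_an(E_p)·#Ш_an(E_{3p²})`, so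
«`ord₂(qB·qA) = 0` ⇒ `Y` is `2`-primitive» for EVERY `Y ∈ E_p(K)` satisfying the display identity —
in particular for HSY's CM point once its display is supplied for it by name. Fact-free; nothing
about `Ш`; no item closed; no label moves; BSD not claimed.
References: Hu–Shu–Yin 2019 pp. 8, 12; memo two §15.1 (odd index), §57.4 (K2).
-/

set_option autoImplicit false
-- the Summit-side namespace `Summit.BirchSwinnertonDyer.BirchSwinnertonDyer.…` (summit = problem) is mandated by D-0017
set_option linter.dupNamespace false

noncomputable section

open scoped Classical

open WeierstrassCurve WeierstrassCurve.Affine WeierstrassCurve.Affine.Point NumberField IsDedekindDomain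
  Literature.NumberTheory.EllipticCurves Literature.NumberTheory.EllipticCurves.HuShuYin2019
  Literature.NumberTheory.QuadraticFields

namespace Summit.BirchSwinnertonDyer.BirchSwinnertonDyer.Theorems.SylvesterTwoCoupledDescentPrimitivity

open Summit.BirchSwinnertonDyer.BirchSwinnertonDyer.Theorems.SylvesterTwoCMNormForm

section Engine

variable {K : Type*} [Field K] [NumberField K]

/-- **`ord₂ q = i` ⇒ `Y ∉ 2B(K) + B(K)_tors`** (equality case of the engine
`SylvesterTwoCMNormForm.le_padicValRat_two_of_model`). `K/ℚ` quadratic with a conjugation datum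
(`θ₀² = c ∈ ℚ`, `θ₀ ∉ ℚ`) and `ω ∈ K` (`ω² + ω + 1 = 0`); `B` a model of `E_p` (`C • B = cubeSumCurve p`,
`p` an odd prime); `P ∈ B(ℚ)` non-torsion in `B(K)` and generating `B(ℚ)` modulo torsion;
`rank_ℤ B(K) = 2`; `Y ∈ B(K)`; `q ≠ 0` with `q·ĥ_K(ιP) = 2^i·ĥ_K(Y)` and `ord₂ q = i`. Then `Y` is
not of the form `2•Q + T` with `T` torsion. [cite: HuShuYin2019, p. 8, p. 12 (bsd)] -/
theorem not_exists_eq_two_smul_add_torsion_of_padicValRat_eq [NeZero (2 : ℚ)]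
    (h2 : Module.finrank ℚ K = 2) {θ₀ : K} {c : ℚ}
    (hθ₀ : θ₀ ∉ Set.range (algebraMap ℚ K)) (hc : θ₀ ^ 2 = algebraMap ℚ K c) {ω : K}
    (hω : ω ^ 2 + ω + 1 = 0) {p : ℕ} (hp : p.Prime) (hp2 : p ≠ 2) (B : WeierstrassCurve ℚ)
    [B.IsElliptic] (C : VariableChange ℚ) (hC : C • B = cubeSumCurve (p : ℚ))
    (hrank : (B.baseChange K).mordellWeilRank = 2) {P : B.toAffine.Point}
    (hP : ¬IsOfFinAddOrder (WeierstrassCurve.QuadraticDescent.incl K B P))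
    (hgen : ∀ Q : B.toAffine.Point, ∃ m : ℤ, IsOfFinAddOrder
      (WeierstrassCurve.QuadraticDescent.incl K B Q - m • WeierstrassCurve.QuadraticDescent.incl K B P))
    (Y : (B.baseChange K).toAffine.Point) {q : ℚ} (hq : q ≠ 0) {i : ℤ}
    (hid : (q : ℝ) * canonicalHeight (WeierstrassCurve.QuadraticDescent.incl K B P) =
      (2 : ℝ) ^ i * canonicalHeight Y) (hv : padicValRat 2 q = i) :
    ¬ ∃ (Q T : (B.baseChange K).toAffine.Point), IsOfFinAddOrder T ∧ Y = 2 • Q + T := by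
  -- the Mordell model `W' = (C • B)_K` and the transport `φ` (as in the engine)
  have ha1 : ((C • B).baseChange K).a₁ = 0 := by rw [hC]; simp [cubeSumCurve, WeierstrassCurve.baseChange]
  have ha2 : ((C • B).baseChange K).a₂ = 0 := by rw [hC]; simp [cubeSumCurve, WeierstrassCurve.baseChange]
  have ha3 : ((C • B).baseChange K).a₃ = 0 := by rw [hC]; simp [cubeSumCurve, WeierstrassCurve.baseChange]
  have ha4 : ((C • B).baseChange K).a₄ = 0 := by rw [hC]; simp [cubeSumCurve, WeierstrassCurve.baseChange]
  haveI hBK : (B.baseChange K).IsElliptic := inferInstanceAs (B.map (algebraMap ℚ K)).IsElliptic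
  haveI hCBK : ((C • B).baseChange K).IsElliptic :=
    inferInstanceAs ((C • B).map (algebraMap ℚ K)).IsElliptic
  set φ := VariableChange.pointEquivBaseChange B C K with hφdef
  have hφh : ∀ X, canonicalHeight (φ X) = canonicalHeight X := fun X =>
    canonicalHeight_pointEquivBaseChange B C X
  -- `[ω]`
  obtain ⟨θ, hθ⟩ := exists_omegaRot (W := (C • B).baseChange K) hω ha1 ha2 ha3 ha4
  have hθ0 : (θ : _ → _) 0 = 0 := map_zero θ
  have hθ3 : ∀ X, θ.toAddMonoidHom (θ.toAddMonoidHom X) + θ.toAddMonoidHom X + X = 0 := fun X =>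
    omegaRot_omegaRot_add_omegaRot_add hω ha1 ha2 ha3 ha4 hθ0 hθ (omega_ne_one hω) X
  -- `P' = φ(ιP)`: non-torsion, `P' ∉ 2W'(K) + tors`
  set P' := φ (WeierstrassCurve.QuadraticDescent.incl K B P) with hP'def
  have hP' : ¬IsOfFinAddOrder P' := fun h =>
    hP ((φ.injective.isOfFinAddOrder_iff (f := φ.toAddMonoidHom)).mp h)
  have h2tor : ∀ X : ((C • B).baseChange K).toAffine.Point, 2 • X = 0 → X = 0 :=
    Summit.BirchSwinnertonDyer.BirchSwinnertonDyer.Theorems.SylvesterTwoFrame.two_torsion_eq_zero_of_model_of_finrank_eq_two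
      K h2 hp hp2 (C • B) ⟨1, by rw [one_smul, hC]⟩
  have hσσ : ∀ X, WeierstrassCurve.QuadraticDescent.conjMap (C • B) (Quadratic.conj h2 hθ₀ hc)
      (WeierstrassCurve.QuadraticDescent.conjMap (C • B) (Quadratic.conj h2 hθ₀ hc) X) = X :=
    WeierstrassCurve.QuadraticDescent.conjMap_conjMap (C • B) (Quadratic.conj_conj h2 hθ₀ hc)
  have hσP : WeierstrassCurve.QuadraticDescent.conjMap (C • B) (Quadratic.conj h2 hθ₀ hc) P' = P' := by
    rw [hP'def, hφdef]
    show Affine.Point.map _ (VariableChange.pointEquivBaseChange B C K _) = _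
    rw [VariableChange.pointEquivBaseChange_map]
    exact congrArg (VariableChange.pointEquivBaseChange B C K)
      (WeierstrassCurve.QuadraticDescent.conjMap_incl B (Quadratic.conj h2 hθ₀ hc) P)
  have hP2 : ¬ ∃ (Q T : ((C • B).baseChange K).toAffine.Point), IsOfFinAddOrder T ∧ P' = 2 • Q + T :=
    not_exists_eq_two_smul_add_torsion
      (WeierstrassCurve.QuadraticDescent.conjMap (C • B) (Quadratic.conj h2 hθ₀ hc)) hσσ h2tor hP' hσP
      (fun X hX => descends_of_generator h2 hθ₀ hc B C hgen X hX)
  -- the `K`-line and the odd representative `n'•φY = a'•P' + b'•[ω]P' + T'`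
  have hr : Module.finrank ℤ ((C • B).baseChange K).toAffine.Point = 2 := by
    rw [← φ.toIntLinearEquiv.finrank_eq]
    exact hrank
  obtain ⟨n, a, b, hn, hY'⟩ :=
    exists_zsmul_eq_of_finrank_eq_two hω ha1 ha2 ha3 ha4 hθ0 hθ hr hP' (φ Y)
  obtain ⟨n', a', b', T', hodd, hT', hY''⟩ := exists_odd_zsmul_eq θ.toAddMonoidHom hθ3 P' hP2
    n.natAbs le_rfl hn IsOfFinAddOrder.zero hY'
  have hn0 : n' ≠ 0 := by rintro rfl; exact hodd ⟨0, rfl⟩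
  -- the explicit quotient: `q = 2^i (a'² − a'b' + b'²)/n'²`, so `ord₂ (a'² − a'b' + b'²) = 0`
  have hid' : (q : ℝ) * canonicalHeight P' = (2 : ℝ) ^ i * canonicalHeight (φ Y) := by
    rw [hP'def, hφh, hφh]; exact hid
  obtain ⟨hab, hqe⟩ := eq_two_zpow_mul_norm_div_sq_of_height_identity hω ha1 ha2 ha3 ha4 hθ0 hθ
    hP' hT' hn0 hY'' hq hid'
  have hNne : ((a' ^ 2 - a' * b' + b' ^ 2 : ℤ) : ℚ) ≠ 0 := by
    exact_mod_cast fun h0 => hab (norm_eq_zero_iff.mp h0)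
  have hn2 : ((n' : ℚ) ^ 2) ≠ 0 := pow_ne_zero 2 (by exact_mod_cast hn0)
  have hne : ((((a' ^ 2 - a' * b' + b' ^ 2 : ℤ) : ℚ)) / ((n' : ℚ) ^ 2)) ≠ 0 := div_ne_zero hNne hn2
  have h22 : padicValRat 2 (2 : ℚ) = 1 := by exact_mod_cast padicValRat.self one_lt_two
  have hvn : padicValRat 2 (n' : ℚ) = 0 := by
    rw [padicValRat.of_int, padicValInt.eq_zero_of_not_dvd hodd]
    rfl
  rw [hqe, padicValRat.mul (zpow_ne_zero i two_ne_zero) hne, padicValRat.zpow, h22, mul_one,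
    padicValRat.div hNne hn2, padicValRat.pow, hvn, mul_zero, sub_zero, padicValRat.of_int] at hv
  have hv0 : padicValInt 2 (a' ^ 2 - a' * b' + b' ^ 2) = 0 := by omega
  have hnot : ¬ (2 ∣ a' ∧ 2 ∣ b') := by
    rintro ⟨⟨a₀, rfl⟩, ⟨b₀, rfl⟩⟩
    have hdvd : (2 : ℤ) ∣ (2 * a₀) ^ 2 - (2 * a₀) * (2 * b₀) + (2 * b₀) ^ 2 :=
      ⟨2 * (a₀ ^ 2 - a₀ * b₀ + b₀ ^ 2), by ring⟩
    have hne0 : (2 * a₀) ^ 2 - (2 * a₀) * (2 * b₀) + (2 * b₀) ^ 2 ≠ 0 := fun h0 =>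
      hab (norm_eq_zero_iff.mp h0)
    rcases (padicValInt_dvd_iff (p := 2) 1 _).mp (by simpa using hdvd) with h0 | h1
    · exact hne0 h0
    · omega
  -- were `Y ∈ 2B(K) + tors`, transport by `φ` and conclude `2 ∣ a', 2 ∣ b'`
  rintro ⟨Q, T, hT, hYQ⟩
  apply hnot
  refine two_dvd_of_memTwo θ.toAddMonoidHom hθ3 P' hP2 ⟨n' • φ Q, n' • φ T - T', ?_, ?_⟩
  · have hT1 : IsOfFinAddOrder (n' • φ T) := (φ.toAddMonoidHom.isOfFinAddOrder hT).zsmul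
    have hmem : n' • φ T - T' ∈ AddCommGroup.torsion _ :=
      sub_mem ((AddCommGroup.mem_torsion _).mpr hT1) ((AddCommGroup.mem_torsion _).mpr hT')
    exact (AddCommGroup.mem_torsion _).mp hmem
  · have e : n' • φ Y = 2 • (n' • φ Q) + n' • φ T := by
      rw [hYQ, map_add, map_nsmul, smul_add, smul_comm n' (2 : ℕ) (φ Q)]
    have h3 : a' • P' + b' • θ.toAddMonoidHom P' = n' • φ Y - T' := by rw [hY'']; abel
    rw [h3, e]
    abel

/-- **In particular `¬ ∃ Q, 2 • Q = Y`** — the hypothesis `hY` of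
`SylvesterTwoCoupledDescentAtTwo.selmerGroup_eq_bot_and_le_closure_of_coupledLeaves` at `p = 2`
(there in the form `¬ ∃ Q, (2 : ℕ) • Q = Y`). [cite: HuShuYin2019, p. 12 (bsd)] -/
theorem not_exists_two_smul_eq_of_padicValRat_eq [NeZero (2 : ℚ)]
    (h2 : Module.finrank ℚ K = 2) {θ₀ : K} {c : ℚ}
    (hθ₀ : θ₀ ∉ Set.range (algebraMap ℚ K)) (hc : θ₀ ^ 2 = algebraMap ℚ K c) {ω : K}
    (hω : ω ^ 2 + ω + 1 = 0) {p : ℕ} (hp : p.Prime) (hp2 : p ≠ 2) (B : WeierstrassCurve ℚ)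
    [B.IsElliptic] (C : VariableChange ℚ) (hC : C • B = cubeSumCurve (p : ℚ))
    (hrank : (B.baseChange K).mordellWeilRank = 2) {P : B.toAffine.Point}
    (hP : ¬IsOfFinAddOrder (WeierstrassCurve.QuadraticDescent.incl K B P))
    (hgen : ∀ Q : B.toAffine.Point, ∃ m : ℤ, IsOfFinAddOrder
      (WeierstrassCurve.QuadraticDescent.incl K B Q - m • WeierstrassCurve.QuadraticDescent.incl K B P))
    (Y : (B.baseChange K).toAffine.Point) {q : ℚ} (hq : q ≠ 0) {i : ℤ}
    (hid : (q : ℝ) * canonicalHeight (WeierstrassCurve.QuadraticDescent.incl K B P) =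
      (2 : ℝ) ^ i * canonicalHeight Y) (hv : padicValRat 2 q = i) :
    ¬ ∃ Q : (B.baseChange K).toAffine.Point, (2 : ℕ) • Q = Y := by
  rintro ⟨Q, hQ⟩
  exact not_exists_eq_two_smul_add_torsion_of_padicValRat_eq h2 hθ₀ hc hω hp hp2 B C hC hrank hP
    hgen Y hq hid hv ⟨Q, 0, IsOfFinAddOrder.zero, by rw [add_zero, hQ]⟩

end Engine

/-! ## The first layer's conclusion from a height display, `ord₂ q = i`, and the coupled leaves -/

section FirstLayer

open Summit.BirchSwinnertonDyer.BirchSwinnertonDyer.Theorems.SylvesterTwoCoupledDescentAtTwo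
  Summit.BirchSwinnertonDyer.BirchSwinnertonDyer.Theorems.SylvesterTwoCoupledDescentShaCurrency

variable {K : Type} [Field K] [NumberField K]

/-- **THE FIRST LAYER'S CONCLUSION `#Ш(B/ℚ)[2^∞] = #Ш(A/ℚ)[2^∞] = 1` FROM: a height display
`q·ĥ(ιP) = 2^i·ĥ(Y)` for a point `Y ∈ B(K)` with `ord₂ q = i`, AND the three coupled leaves for the
Kummer class of (the transport of) THAT `Y`.** Frame: `K/ℚ` quadratic with a conjugation datum and
`ω ∈ K`; `B`, `A` models of `E_p`, `E_{3p²}` (`C_B • B = cubeSumCurve p`, `C_A • A = cubeSumCurve (3p²)`,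
`p` an odd prime); `P ∈ B(ℚ)` a generator modulo torsion, non-torsion in `B(K)`; `rank_ℤ B(K) = 2`
(all as in Hu–Shu–Yin's display `shaAnPair_mul_height_eq_two_zpow_mul_height`, where for
`p ≡ 4 (9)` `i = 0` and `q = #Ш_an(E_p)·#Ш_an(E_{3p²})`, so `ord₂ q = i` is `stub_firstLayerFour`'s
hypothesis `padicValRat 2 (qB * qA) = 0`); `w` an operator on `H¹(K, (C_B • B)_K[2])` over an
endomorphism `g` of `H¹(K, (C_B • B)_K)` (the CM operator `[ω]`); and, with
`Y₀ := pointEquivBaseChange B C_B K Y ∈ (C_B • B)(K)` and `y := δY₀`, the leaves (L1), (L2A), (L2B),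
(L3a), (L3b) of `selmerGroup_eq_bot_and_le_closure_of_coupledLeaves` at `p = 2` for the pair
`((C_A • A), (C_B • B))` over `K` and an inert-prime predicate `Kol`. Chain:
`not_exists_two_smul_eq_of_padicValRat_eq` (`Y`, hence `Y₀`, is not `2`-divisible) ⇒ p620148
(THEOREM K2, Selmer form) ⇒ `…ShaCurrency` (Ш over `K`, then over `ℚ` by k-ty1 p608170).
What remains OUTSIDE this theorem for `stub_firstLayerFour`: the leaves (rows k-p1/k-p2) and a
display naming HSY's CM point `Y` (the tree's display fact only says `∃ Y`). -/
theorem natCard_primaryComponent_sha_eq_one_pair_of_display_of_coupledLeaves [NeZero (2 : ℚ)]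
    (h2 : Module.finrank ℚ K = 2) {θ₀ : K} {c : ℚ}
    (hθ₀ : θ₀ ∉ Set.range (algebraMap ℚ K)) (hc : θ₀ ^ 2 = algebraMap ℚ K c) {ω : K}
    (hω : ω ^ 2 + ω + 1 = 0) {p : ℕ} (hp : p.Prime) (hp2 : p ≠ 2) (A B : WeierstrassCurve ℚ)
    [A.IsElliptic] [B.IsElliptic] (CA CB : VariableChange ℚ)
    (hCA : CA • A = cubeSumCurve (3 * (p : ℚ) ^ 2)) (hCB : CB • B = cubeSumCurve (p : ℚ))
    (hrank : (B.baseChange K).mordellWeilRank = 2) {P : B.toAffine.Point}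
    (hP : ¬IsOfFinAddOrder (WeierstrassCurve.QuadraticDescent.incl K B P))
    (hgen : ∀ Q : B.toAffine.Point, ∃ m : ℤ, IsOfFinAddOrder
      (WeierstrassCurve.QuadraticDescent.incl K B Q - m • WeierstrassCurve.QuadraticDescent.incl K B P))
    (Y : (B.baseChange K).toAffine.Point) {q : ℚ} (hq : q ≠ 0) {i : ℤ}
    (hid : (q : ℝ) * canonicalHeight (WeierstrassCurve.QuadraticDescent.incl K B P) =
      (2 : ℝ) ^ i * canonicalHeight Y) (hv : padicValRat 2 q = i)
    (Kol : ℕ → Prop) (hKol : ∀ ℓ, Kol ℓ → ℓ.Prime ∧ (Ideal.span {(ℓ : 𝓞 K)}).IsPrime)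
    (w : galH1Torsion ((CB • B).baseChange K) (2 : ℕ) →+ galH1Torsion ((CB • B).baseChange K) (2 : ℕ))
    (g : ((CB • B).baseChange K).galH1 →+ ((CB • B).baseChange K).galH1)
    (hw : ∀ x, torsionH1ToH1 ((CB • B).baseChange K) (2 : ℕ) (w x) =
      g (torsionH1ToH1 ((CB • B).baseChange K) (2 : ℕ) x))
    (hL1 : ∃ (cA : ℕ → galH1Torsion ((CA • A).baseChange K) (2 : ℕ))
        (cB : ℕ → galH1Torsion ((CB • B).baseChange K) (2 : ℕ)),
      (∀ ℓ, Kol ℓ →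
        (∀ v : HeightOneSpectrum (𝓞 K), (ℓ : 𝓞 K) ∉ v.asIdeal →
          cA ℓ ∈ selmerLocalKer ((CA • A).baseChange K) (v.adicCompletion K) (2 : ℕ)) ∧
        (∀ x : InfinitePlace K, cA ℓ ∈ selmerLocalKer ((CA • A).baseChange K) x.Completion (2 : ℕ)) ∧
        (∀ v : HeightOneSpectrum (𝓞 K), (ℓ : 𝓞 K) ∈ v.asIdeal →
          (cA ℓ ∈ selmerLocalKer ((CA • A).baseChange K) (v.adicCompletion K) (2 : ℕ) ↔
            kummerClassOfPoint (CB • B) K Nat.prime_two (VariableChange.pointEquivBaseChange B CB K Y) ∈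
              ((CB • B).baseChange K).torsionLocalKer (v.adicCompletion K) (2 : ℕ)))) ∧
      (∀ ℓ ℓ', Kol ℓ → Kol ℓ' → ℓ ≠ ℓ' →
        (∀ v : HeightOneSpectrum (𝓞 K), (ℓ : 𝓞 K) ∉ v.asIdeal → (ℓ' : 𝓞 K) ∉ v.asIdeal →
          cB (ℓ * ℓ') ∈ selmerLocalKer ((CB • B).baseChange K) (v.adicCompletion K) (2 : ℕ)) ∧
        (∀ x : InfinitePlace K,
          cB (ℓ * ℓ') ∈ selmerLocalKer ((CB • B).baseChange K) x.Completion (2 : ℕ)) ∧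
        (∀ v : HeightOneSpectrum (𝓞 K), (ℓ : 𝓞 K) ∈ v.asIdeal →
          (cB (ℓ * ℓ') ∈ selmerLocalKer ((CB • B).baseChange K) (v.adicCompletion K) (2 : ℕ) ↔
            cA ℓ' ∈ ((CA • A).baseChange K).torsionLocalKer (v.adicCompletion K) (2 : ℕ)))))
    (hL2A : ∀ ℓ, Kol ℓ → ∀ d : galH1Torsion ((CA • A).baseChange K) (2 : ℕ),
      (∀ v : HeightOneSpectrum (𝓞 K), (ℓ : 𝓞 K) ∉ v.asIdeal →
        d ∈ selmerLocalKer ((CA • A).baseChange K) (v.adicCompletion K) (2 : ℕ)) →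
      (∀ x : InfinitePlace K, d ∈ selmerLocalKer ((CA • A).baseChange K) x.Completion (2 : ℕ)) →
      ∀ v : HeightOneSpectrum (𝓞 K), (ℓ : 𝓞 K) ∈ v.asIdeal →
        d ∉ selmerLocalKer ((CA • A).baseChange K) (v.adicCompletion K) (2 : ℕ) →
        ∀ s ∈ selmerGroup ((CA • A).baseChange K) (2 : ℕ),
          s ∈ ((CA • A).baseChange K).torsionLocalKer (v.adicCompletion K) (2 : ℕ))
    (hL2B : ∀ ℓ, Kol ℓ → ∀ d : galH1Torsion ((CB • B).baseChange K) (2 : ℕ),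
      (∀ v : HeightOneSpectrum (𝓞 K), (ℓ : 𝓞 K) ∉ v.asIdeal →
        d ∈ selmerLocalKer ((CB • B).baseChange K) (v.adicCompletion K) (2 : ℕ)) →
      (∀ x : InfinitePlace K, d ∈ selmerLocalKer ((CB • B).baseChange K) x.Completion (2 : ℕ)) →
      ∀ v : HeightOneSpectrum (𝓞 K), (ℓ : 𝓞 K) ∈ v.asIdeal →
        d ∉ selmerLocalKer ((CB • B).baseChange K) (v.adicCompletion K) (2 : ℕ) →
        ∀ s ∈ selmerGroup ((CB • B).baseChange K) (2 : ℕ),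
          s ∈ ((CB • B).baseChange K).torsionLocalKer (v.adicCompletion K) (2 : ℕ))
    (hL3a : ∀ (s : galH1Torsion ((CA • A).baseChange K) (2 : ℕ))
      (t : galH1Torsion ((CB • B).baseChange K) (2 : ℕ)),
      Set.Infinite {ℓ : ℕ | Kol ℓ ∧ ∀ v : HeightOneSpectrum (𝓞 K), (ℓ : 𝓞 K) ∈ v.asIdeal →
        (s ≠ 0 → s ∉ ((CA • A).baseChange K).torsionLocalKer (v.adicCompletion K) (2 : ℕ)) ∧
        (t ≠ 0 → t ∉ ((CB • B).baseChange K).torsionLocalKer (v.adicCompletion K) (2 : ℕ))})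
    (hL3b : ∀ s ∈ selmerGroup ((CB • B).baseChange K) (2 : ℕ),
      (¬ ∃ a b : ℤ, s = a • kummerClassOfPoint (CB • B) K Nat.prime_two
          (VariableChange.pointEquivBaseChange B CB K Y) +
        b • w (kummerClassOfPoint (CB • B) K Nat.prime_two
          (VariableChange.pointEquivBaseChange B CB K Y))) →
      ∀ x : galH1Torsion ((CA • A).baseChange K) (2 : ℕ), x ≠ 0 →
      Set.Infinite {ℓ : ℕ | Kol ℓ ∧ ∀ v : HeightOneSpectrum (𝓞 K), (ℓ : 𝓞 K) ∈ v.asIdeal →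
        kummerClassOfPoint (CB • B) K Nat.prime_two (VariableChange.pointEquivBaseChange B CB K Y) ∈
          ((CB • B).baseChange K).torsionLocalKer (v.adicCompletion K) (2 : ℕ) ∧
        s ∉ ((CB • B).baseChange K).torsionLocalKer (v.adicCompletion K) (2 : ℕ) ∧
        x ∉ ((CA • A).baseChange K).torsionLocalKer (v.adicCompletion K) (2 : ℕ)}) :
    Nat.card (AddCommGroup.primaryComponent B.sha 2) = 1 ∧
      Nat.card (AddCommGroup.primaryComponent A.sha 2) = 1 := by
  haveI : Fact (Nat.Prime 2) := ⟨Nat.prime_two⟩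
  haveI hCBK : ((CB • B).baseChange K).IsElliptic :=
    inferInstanceAs ((CB • B).map (algebraMap ℚ K)).IsElliptic
  haveI hCAK : ((CA • A).baseChange K).IsElliptic :=
    inferInstanceAs ((CA • A).map (algebraMap ℚ K)).IsElliptic
  set φ := VariableChange.pointEquivBaseChange B CB K with hφdef
  -- `Y`, hence `Y₀ = φ Y`, is not `2`-divisible
  have hY : ¬ ∃ Q : (B.baseChange K).toAffine.Point, (2 : ℕ) • Q = Y :=
    not_exists_two_smul_eq_of_padicValRat_eq h2 hθ₀ hc hω hp hp2 B CB hCB hrank hP hgen Y hq hid hv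
  have hY₀ : ¬ ∃ Q : ((CB • B).baseChange K).toAffine.Point, (2 : ℕ) • Q = φ Y := by
    rintro ⟨Q, hQ⟩
    refine hY ⟨φ.symm Q, φ.injective ?_⟩
    rw [map_nsmul, AddEquiv.apply_symm_apply, hQ]
  -- THEOREM K2 (Selmer form) for the short pair over `K`
  obtain ⟨hK2A, hK2B⟩ := selmerGroup_eq_bot_and_le_closure_of_coupledLeaves (CA • A) (CB • B)
    Nat.prime_two Kol hKol hY₀ w hL1 hL2A hL2B hL3a hL3b
  -- Ш over `K`, then over `ℚ`
  have hBK : Nat.card (AddCommGroup.primaryComponent ((CB • B).baseChange K).sha 2) = 1 :=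
    natCard_primaryComponent_sha_eq_one_of_selmerGroup_le_closure (CB • B) Nat.prime_two (φ Y) w g
      hw hK2B
  have hAK : Nat.card (AddCommGroup.primaryComponent ((CA • A).baseChange K).sha 2) = 1 :=
    natCard_primaryComponent_sha_eq_one_of_selmerGroup_eq_bot ((CA • A).baseChange K) 2 hK2A
  have hCB' : CB • B = ⟨0, 0, 0, 0, -432 * (p : ℚ) ^ 2⟩ := hCB
  have hCA' : CA • A = ⟨0, 0, 0, 0, -432 * (3 * (p : ℚ) ^ 2) ^ 2⟩ := hCA
  refine ⟨JZero.natCard_primaryComponent_sha_eq_one_of_variableChange K hCB' hω h2 2 ?_,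
    JZero.natCard_primaryComponent_sha_eq_one_of_variableChange K hCA' hω h2 2 ?_⟩
  · rw [← hCB']; exact hBK
  · rw [← hCA']; exact hAK

/-- **The HALVED form (shape of `stub_firstLayerSeven`, memo two §67 COROLLARY K2(7)).** Same as
`natCard_primaryComponent_sha_eq_one_pair_of_display_of_coupledLeaves`, but the display is for a
point `Y = 2•Y′ + T` (`T` torsion) — on `p ≡ 7 (9)` this halving is THEOREM C (crux 19802
`HSYPointTwoDivisibleSevenModNine`) and Hu–Shu–Yin's display has `i = −2` — so that
`q·ĥ(ιP) = 2^{i+2}·ĥ(Y′)` (`ĥ(2Y′ + T) = 4ĥ(Y′)`), the hypothesis becomes `ord₂ q = i + 2` (`= 0` for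
the stub), and the leaves are those of the Kummer class of (the transport of) `Y′` — the halved
system of memo two §64.7/§67. Conclusion: `#Ш(B/ℚ)[2^∞] = #Ш(A/ℚ)[2^∞] = 1`. -/
theorem natCard_primaryComponent_sha_eq_one_pair_of_display_of_halving_of_coupledLeaves
    [NeZero (2 : ℚ)] (h2 : Module.finrank ℚ K = 2) {θ₀ : K} {c : ℚ}
    (hθ₀ : θ₀ ∉ Set.range (algebraMap ℚ K)) (hc : θ₀ ^ 2 = algebraMap ℚ K c) {ω : K}
    (hω : ω ^ 2 + ω + 1 = 0) {p : ℕ} (hp : p.Prime) (hp2 : p ≠ 2) (A B : WeierstrassCurve ℚ)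
    [A.IsElliptic] [B.IsElliptic] (CA CB : VariableChange ℚ)
    (hCA : CA • A = cubeSumCurve (3 * (p : ℚ) ^ 2)) (hCB : CB • B = cubeSumCurve (p : ℚ))
    (hrank : (B.baseChange K).mordellWeilRank = 2) {P : B.toAffine.Point}
    (hP : ¬IsOfFinAddOrder (WeierstrassCurve.QuadraticDescent.incl K B P))
    (hgen : ∀ Q : B.toAffine.Point, ∃ m : ℤ, IsOfFinAddOrder
      (WeierstrassCurve.QuadraticDescent.incl K B Q - m • WeierstrassCurve.QuadraticDescent.incl K B P))
    (Y Y' T : (B.baseChange K).toAffine.Point) (hT : IsOfFinAddOrder T) (hYY' : Y = (2 : ℤ) • Y' + T)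
    {q : ℚ} (hq : q ≠ 0) {i : ℤ}
    (hid : (q : ℝ) * canonicalHeight (WeierstrassCurve.QuadraticDescent.incl K B P) =
      (2 : ℝ) ^ i * canonicalHeight Y) (hv : padicValRat 2 q = i + 2)
    (Kol : ℕ → Prop) (hKol : ∀ ℓ, Kol ℓ → ℓ.Prime ∧ (Ideal.span {(ℓ : 𝓞 K)}).IsPrime)
    (w : galH1Torsion ((CB • B).baseChange K) (2 : ℕ) →+ galH1Torsion ((CB • B).baseChange K) (2 : ℕ))
    (g : ((CB • B).baseChange K).galH1 →+ ((CB • B).baseChange K).galH1)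
    (hw : ∀ x, torsionH1ToH1 ((CB • B).baseChange K) (2 : ℕ) (w x) =
      g (torsionH1ToH1 ((CB • B).baseChange K) (2 : ℕ) x))
    (hL1 : ∃ (cA : ℕ → galH1Torsion ((CA • A).baseChange K) (2 : ℕ))
        (cB : ℕ → galH1Torsion ((CB • B).baseChange K) (2 : ℕ)),
      (∀ ℓ, Kol ℓ →
        (∀ v : HeightOneSpectrum (𝓞 K), (ℓ : 𝓞 K) ∉ v.asIdeal →
          cA ℓ ∈ selmerLocalKer ((CA • A).baseChange K) (v.adicCompletion K) (2 : ℕ)) ∧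
        (∀ x : InfinitePlace K, cA ℓ ∈ selmerLocalKer ((CA • A).baseChange K) x.Completion (2 : ℕ)) ∧
        (∀ v : HeightOneSpectrum (𝓞 K), (ℓ : 𝓞 K) ∈ v.asIdeal →
          (cA ℓ ∈ selmerLocalKer ((CA • A).baseChange K) (v.adicCompletion K) (2 : ℕ) ↔
            kummerClassOfPoint (CB • B) K Nat.prime_two (VariableChange.pointEquivBaseChange B CB K Y') ∈
              ((CB • B).baseChange K).torsionLocalKer (v.adicCompletion K) (2 : ℕ)))) ∧
      (∀ ℓ ℓ', Kol ℓ → Kol ℓ' → ℓ ≠ ℓ' →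
        (∀ v : HeightOneSpectrum (𝓞 K), (ℓ : 𝓞 K) ∉ v.asIdeal → (ℓ' : 𝓞 K) ∉ v.asIdeal →
          cB (ℓ * ℓ') ∈ selmerLocalKer ((CB • B).baseChange K) (v.adicCompletion K) (2 : ℕ)) ∧
        (∀ x : InfinitePlace K,
          cB (ℓ * ℓ') ∈ selmerLocalKer ((CB • B).baseChange K) x.Completion (2 : ℕ)) ∧
        (∀ v : HeightOneSpectrum (𝓞 K), (ℓ : 𝓞 K) ∈ v.asIdeal →
          (cB (ℓ * ℓ') ∈ selmerLocalKer ((CB • B).baseChange K) (v.adicCompletion K) (2 : ℕ) ↔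
            cA ℓ' ∈ ((CA • A).baseChange K).torsionLocalKer (v.adicCompletion K) (2 : ℕ)))))
    (hL2A : ∀ ℓ, Kol ℓ → ∀ d : galH1Torsion ((CA • A).baseChange K) (2 : ℕ),
      (∀ v : HeightOneSpectrum (𝓞 K), (ℓ : 𝓞 K) ∉ v.asIdeal →
        d ∈ selmerLocalKer ((CA • A).baseChange K) (v.adicCompletion K) (2 : ℕ)) →
      (∀ x : InfinitePlace K, d ∈ selmerLocalKer ((CA • A).baseChange K) x.Completion (2 : ℕ)) →
      ∀ v : HeightOneSpectrum (𝓞 K), (ℓ : 𝓞 K) ∈ v.asIdeal →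
        d ∉ selmerLocalKer ((CA • A).baseChange K) (v.adicCompletion K) (2 : ℕ) →
        ∀ s ∈ selmerGroup ((CA • A).baseChange K) (2 : ℕ),
          s ∈ ((CA • A).baseChange K).torsionLocalKer (v.adicCompletion K) (2 : ℕ))
    (hL2B : ∀ ℓ, Kol ℓ → ∀ d : galH1Torsion ((CB • B).baseChange K) (2 : ℕ),
      (∀ v : HeightOneSpectrum (𝓞 K), (ℓ : 𝓞 K) ∉ v.asIdeal →
        d ∈ selmerLocalKer ((CB • B).baseChange K) (v.adicCompletion K) (2 : ℕ)) →
      (∀ x : InfinitePlace K, d ∈ selmerLocalKer ((CB • B).baseChange K) x.Completion (2 : ℕ)) →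
      ∀ v : HeightOneSpectrum (𝓞 K), (ℓ : 𝓞 K) ∈ v.asIdeal →
        d ∉ selmerLocalKer ((CB • B).baseChange K) (v.adicCompletion K) (2 : ℕ) →
        ∀ s ∈ selmerGroup ((CB • B).baseChange K) (2 : ℕ),
          s ∈ ((CB • B).baseChange K).torsionLocalKer (v.adicCompletion K) (2 : ℕ))
    (hL3a : ∀ (s : galH1Torsion ((CA • A).baseChange K) (2 : ℕ))
      (t : galH1Torsion ((CB • B).baseChange K) (2 : ℕ)),
      Set.Infinite {ℓ : ℕ | Kol ℓ ∧ ∀ v : HeightOneSpectrum (𝓞 K), (ℓ : 𝓞 K) ∈ v.asIdeal →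
        (s ≠ 0 → s ∉ ((CA • A).baseChange K).torsionLocalKer (v.adicCompletion K) (2 : ℕ)) ∧
        (t ≠ 0 → t ∉ ((CB • B).baseChange K).torsionLocalKer (v.adicCompletion K) (2 : ℕ))})
    (hL3b : ∀ s ∈ selmerGroup ((CB • B).baseChange K) (2 : ℕ),
      (¬ ∃ a b : ℤ, s = a • kummerClassOfPoint (CB • B) K Nat.prime_two
          (VariableChange.pointEquivBaseChange B CB K Y') +
        b • w (kummerClassOfPoint (CB • B) K Nat.prime_two
          (VariableChange.pointEquivBaseChange B CB K Y'))) →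
      ∀ x : galH1Torsion ((CA • A).baseChange K) (2 : ℕ), x ≠ 0 →
      Set.Infinite {ℓ : ℕ | Kol ℓ ∧ ∀ v : HeightOneSpectrum (𝓞 K), (ℓ : 𝓞 K) ∈ v.asIdeal →
        kummerClassOfPoint (CB • B) K Nat.prime_two (VariableChange.pointEquivBaseChange B CB K Y') ∈
          ((CB • B).baseChange K).torsionLocalKer (v.adicCompletion K) (2 : ℕ) ∧
        s ∉ ((CB • B).baseChange K).torsionLocalKer (v.adicCompletion K) (2 : ℕ) ∧
        x ∉ ((CA • A).baseChange K).torsionLocalKer (v.adicCompletion K) (2 : ℕ)}) :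
    Nat.card (AddCommGroup.primaryComponent B.sha 2) = 1 ∧
      Nat.card (AddCommGroup.primaryComponent A.sha 2) = 1 := by
  haveI hBK : (B.baseChange K).IsElliptic := inferInstanceAs (B.map (algebraMap ℚ K)).IsElliptic
  -- the display for `Y'` with exponent `i + 2`: `ĥ(2Y' + T) = 4 ĥ(Y')`
  have hY4 : canonicalHeight Y = (2 : ℝ) ^ (2 : ℤ) * canonicalHeight Y' := by
    rw [hYY', canonicalHeight_add_of_isOfFinAddOrder _ T hT, canonicalHeight_zsmul_holds]
    norm_num
  have hid' : (q : ℝ) * canonicalHeight (WeierstrassCurve.QuadraticDescent.incl K B P) =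
      (2 : ℝ) ^ (i + 2) * canonicalHeight Y' := by
    rw [hid, hY4, ← mul_assoc, ← zpow_add₀ (two_ne_zero' ℝ)]
  exact natCard_primaryComponent_sha_eq_one_pair_of_display_of_coupledLeaves h2 hθ₀ hc hω hp hp2 A B
    CA CB hCA hCB hrank hP hgen Y' hq hid' hv Kol hKol w g hw hL1 hL2A hL2B hL3a hL3b

end FirstLayer

end Summit.BirchSwinnertonDyer.BirchSwinnertonDyer.Theorems.SylvesterTwoCoupledDescentPrimitivity

end
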